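import Summits.HodgeConjecture.CorCM.MultiFieldWeilDecoupling
import HarnessLib

/-!
# MULTI-FIELD WEIL ENGINE — THE DIHEDRAL PENTAGON: separation of several position sets over ONE slot of five letters whose image is the dihedral group
# `D₅` (NOT `2`-transitive), from linear independence over `ℚ(√5) = ℚ[A]`, `A = R + R⁻¹ − R² − R⁻²` (census level)

Cell `pub-hodgecm2` (COR-CM), seat b30 gen 42 (2026-08-26); count-neutral own lane MULTI-FIELD WEIL ENGINE (stem `MultiFieldWeil*`), census level (abstract sets of
permutations of `Fin 5`, read as `ℤ/5` through Mathlib's `Fin.CommRing`).  Theorems only; no definition, no named fact, no `sorry`, no `decide` beyond numerals of `Fin 5`.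
HONEST FRAMING: pure finite combinatorics and linear algebra; `HC_CM` is NOT touched.

THE POINT.  Every separation theorem of the units programme so far (`CorCM/MultiFieldWeilUnitSeparation.lean` U1, its converse `…UnitSeparationSharp.lean`, the irreducibility ∕
orthogonality of `…Decoupling.lean`) needs the image `H ≤ Sym(k)` of the realised tuples on the `k` `τ`-embeddings of a CM field to be `2`-TRANSITIVE: then the mass-zero
permutation module is absolutely irreducible, its commutant is `ℚ`, and several position sets `Q_i` (several CM types of one field) separate iff their centred indicators
`c_i = k·𝟙_{Q_i} − |Q_i|` are linearly independent over `ℚ`.  Over a DECIC CM field `K ∋ k` whose quintic part is DIHEDRAL the image on the five `τ`-embeddings is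
`D₅ = {x ↦ x + t, x ↦ t − x}` — transitive, not `2`-transitive; the mass-zero module `V₀ ≅ ℚ(ζ₅)` stays `ℚ`-irreducible but its commutant grows to the real subfield
`ℚ(√5)`, realised inside `ℚ[D₅]` by the self-adjoint operator `(A f)(s) = f(s+1) + f(s−1) − f(s+2) − f(s−2)` (`A² = 5` on `V₀`).  THE CRITERION BECOMES: the `Q_i` separate
iff the `c_i` are linearly independent over `ℚ[A]`, i.e. no relation `Σ_i (x_i + y_i A) c_i = 0` with rational `x_i, y_i` not all zero (so at most TWO classes per field,
`dim_{ℚ(√5)} V₀ = 2`).  This file proves the positive half; the sequel `CorCM/MultiFieldWeilDihedralFiveCriterion.lean` makes the criterion checkable: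

* §1 two identities: the centred form of a signed sum (`two_mul_sum_centred_mul_centred`, any `k`), and THE SYMMETRIC LEMMA `symm_eq_zero_of_fIndependent`: a family of
  SYMMETRIC (`α_i(−a) = α_i(a)`) mass-zero functions whose convolution against the `c_i` sums to a constant vanishes, given `ℚ[A]`-independence — because a symmetric
  mass-zero `α` IS an element `x·1 + y·A` of `ℚ[A]` (`x = −(α(1)+α(2))/2`, `y = (α(1)−α(2))/2`);
* §2 **`const_of_signed_dihedral_five`**: `H ⊆ Sym(5)` containing the ten maps `x ↦ x + t`, `x ↦ t − x`; if the signed sums `Σ_i Σ_a ±_{σ a ∈ Q_i} u_i(a)` are constant on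
  `H` and the `c_i` are `ℚ[A]`-independent, every `u_i` is constant.  PROOF (Fourier analysis on `ℤ/5` written out in coordinates): the rotations say `Σ_i c_i ∗ ū_i^∨` is
  constant, the reflections say `Σ_i c_i ∗ ū_i` is constant (`∗` = convolution, `ū_i = 5u_i − Σu_i`, `f^∨(a) = f(−a)`); adding, the symmetric parts `α_i = ū_i + ū_i^∨`
  vanish by §1; subtracting, `Σ_i c_i ∗ β_i = 0` for the antisymmetric parts, and `γ_i(a) = β_i(a−1) − β_i(a+1)` (i.e. `β_i ∗ (δ₁ − δ₋₁)`) is symmetric with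
  `Σ_i c_i ∗ γ_i = 0`, so `γ_i = 0`, whence `β_i = 0`;
* (sequel §3) THE CRITERION MADE CHECKABLE: `eq_zero_of_fRelation_single` (`x + yA` is invertible on mass-zero functions for `(x, y) ≠ 0`: `(x − yA)(x + yA) = x² − 5y²` and `√5 ∉ ℚ`),
  **`comp_eq_of_fRelation`** (in a relation `(x₁ + y₁A)c₁ + (x₂ + y₂A)c₂ = 0` with `(x₂, y₂) ≠ 0`, every rotation ∕ reflection fixing `c₁` fixes `c₂` — `ℚ[A]` commutes with
  `D₅`), hence **`fIndependent_of_card_le_two`**: at most two proper non-empty position sets such that for `i ≠ j` some rotation ∕ reflection stabilises `Q_j` but not `Q_i`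
  are `ℚ[A]`-independent; for two `2`-subsets `{a, b} ≠ {a', b'}` of `ℤ/5` this says `a + b ≠ a' + b'` (`fIndependent_pairs_of_sum_ne`: the reflection `x ↦ a + b − x`);
* (sequel §4) transport under conjugation (`const_of_signed_of_conj`) and the conjugated form **`const_of_signed_dihedral_five_conj`** (the dihedral maps conjugated by any `g`, as the
  realised tuples present them after `exists_conj_finRotate_of_orderOf_eq`).
The negative half (a `ℚ[A]`-relation gives a non-constant solution; over the CYCLIC pentagon any two sets fail) is `CorCM/MultiFieldWeilCommutantNoGo.lean`; the realised
reading (decic CM fields with Galois closure of degree `20`) follows in the sequel.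
[cite: Serre1977, §2.3 Ex. 2.6; §5.3] [cite: DixonMortimer1996, §1.4 Ex. 1.4.1–1.4.2; §2.1] [cite: Washington1997, Lemma 2.4 and §2 (the real subfield `ℚ(ζ₅ + ζ₅⁻¹) = ℚ(√5)`)]
[cite: Lang2002, XIII §4]

## References
* [Serre1977] J.-P. Serre, *Linear Representations of Finite Groups*, GTM 42, §2.3 Ex. 2.6 (the permutation representation), §5.3 (the dihedral groups).
* [DixonMortimer1996] J. D. Dixon, B. Mortimer, *Permutation Groups*, GTM 163, §1.4 Ex. 1.4.1–1.4.2, §2.1.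
* [Washington1997] L. C. Washington, *Introduction to Cyclotomic Fields*, 2nd ed., GTM 83, §2, Lemma 2.4.
* [Lang2002] S. Lang, *Algebra*, GTM 211, XIII §4.
-/

noncomputable section

namespace Summit.HodgeConjecture.CorCM.MultiFieldWeil

open Finset
open Fin.CommRing

open scoped Classical

/-! ## §1 The centred form of a signed sum; the symmetric lemma -/

section Identities

/-- **The centred form of a signed sum (any size `k`).**  With `χ = 𝟙_Q`, `q = |Q|`, `S = Σ u`:
`2·Σ_a (k·χ(σ a) − q)(k·u(a) − S) = k²·Σ_a ±_{σ a ∈ Q} u(a) + (k² − 2kq)·S` — the signed sum through `Q` is, up to an affine change, the pairing of the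
centred indicator moved by `σ` with the centred defect. [cite: Serre1977, §2.3 Ex. 2.6] -/
theorem two_mul_sum_centred_mul_centred {k : ℕ} (σ : Equiv.Perm (Fin k)) (Q : Finset (Fin k)) (u : Fin k → ℚ) :
    2 * ∑ a, ((k : ℚ) * (if σ a ∈ Q then 1 else 0) - Q.card) * ((k : ℚ) * u a - ∑ b, u b) =
      (k : ℚ) ^ 2 * (∑ a, (if σ a ∈ Q then u a else -u a)) + ((k : ℚ) ^ 2 - 2 * k * Q.card) * ∑ b, u b := by
  have hχ : ∑ a, (if σ a ∈ Q then (1 : ℚ) else 0) = Q.card := by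
    rw [Equiv.sum_comp σ (fun a => if a ∈ Q then (1 : ℚ) else 0), Finset.sum_boole]
    simp
  have hite : ∀ a, (if σ a ∈ Q then u a else -u a) = (2 * (if σ a ∈ Q then (1 : ℚ) else 0) - 1) * u a := fun a => by
    split_ifs <;> ring
  set S : ℚ := ∑ b, u b with hS
  have hpt : ∀ a, 2 * (((k : ℚ) * (if σ a ∈ Q then 1 else 0) - Q.card) * ((k : ℚ) * u a - S)) =
      (k : ℚ) ^ 2 * (if σ a ∈ Q then u a else -u a) +
        ((-2 * k * S) * (if σ a ∈ Q then (1 : ℚ) else 0) + ((k : ℚ) ^ 2 - 2 * Q.card * k) * u a + 2 * Q.card * S) := fun a => by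
    rw [hite]; ring
  rw [Finset.mul_sum, Finset.sum_congr rfl fun a _ => hpt a, Finset.sum_add_distrib, Finset.sum_add_distrib, Finset.sum_add_distrib,
    ← Finset.mul_sum, ← Finset.mul_sum, ← Finset.mul_sum, hχ, Finset.sum_const, Finset.card_univ, Fintype.card_fin, nsmul_eq_mul, ← hS]
  ring

/-- `(5 : ℤ/5) = 0`. [folklore] -/
theorem five_eq_zero_fin : (5 : Fin 5) = 0 := by decide

/-- **THE SYMMETRIC LEMMA.**  `c_i : ℤ/5 → ℚ` mass-zero and `ℚ[A]`-independent (`A c(s) = c(s+1) + c(s−1) − c(s+2) − c(s−2)`: no relation `Σ_i (x_i c_i + y_i A c_i) = 0`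
with rational `x_i, y_i` not all zero); `α_i` SYMMETRIC (`α_i(−a) = α_i(a)`) and mass-zero; if the convolutions `Σ_i Σ_a c_i(t − a) α_i(a)` do not depend on `t`,
then every `α_i = 0`.  Indeed the constant is `0` (sum over `t`), and for symmetric mass-zero `α`, `2 Σ_a c(t−a) α(a) = −5(α(1)+α(2))·c(t) + (α(1)−α(2))·A c(t)`.
[cite: Serre1977, §5.3] [cite: Washington1997, Lemma 2.4] -/
theorem symm_eq_zero_of_fIndependent {ι : Type} [Fintype ι] (c : ι → Fin 5 → ℚ) (hc0 : ∀ i, ∑ s, c i s = 0)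
    (hF : ∀ x y : ι → ℚ, (∀ s : Fin 5, ∑ i, (x i * c i s + y i * (c i (s + 1) + c i (s - 1) - c i (s + 2) - c i (s - 2))) = 0) →
      ∀ i, x i = 0 ∧ y i = 0)
    (α : ι → Fin 5 → ℚ) (hsym : ∀ i a, α i (-a) = α i a) (hmass : ∀ i, ∑ a, α i a = 0)
    {C : ℚ} (hP : ∀ t : Fin 5, ∑ i, ∑ a, c i (t - a) * α i a = C) : ∀ i a, α i a = 0 := by
  have h4 : ∀ i, α i 4 = α i 1 := fun i => by
    have e : (-1 : Fin 5) = 4 := by decide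
    have := hsym i 1; rwa [e] at this
  have h3 : ∀ i, α i 3 = α i 2 := fun i => by
    have e : (-2 : Fin 5) = 3 := by decide
    have := hsym i 2; rwa [e] at this
  have h0 : ∀ i, α i 0 = -2 * α i 1 - 2 * α i 2 := fun i => by
    have := hmass i
    rw [Fin.sum_univ_five, h3, h4] at this
    linarith
  -- the expansion `2 P_i(s) = x_i c_i(s) + y_i (A c_i)(s)`
  have hexp : ∀ i s, 2 * ∑ a, c i (s - a) * α i a =
      (-5 * (α i 1 + α i 2)) * c i s + (α i 1 - α i 2) * (c i (s + 1) + c i (s - 1) - c i (s + 2) - c i (s - 2)) := by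
    intro i s
    have hm : c i s + c i (s + 1) + c i (s + 2) + c i (s - 2) + c i (s - 1) = 0 := by
      have h := hc0 i
      rw [← Equiv.sum_comp (Equiv.addLeft s) (c i), Fin.sum_univ_five] at h
      have e0 : s + 0 = s := add_zero s
      have e3 : s + 3 = s - 2 := by linear_combination five_eq_zero_fin
      have e4 : s + 4 = s - 1 := by linear_combination five_eq_zero_fin
      simp only [Equiv.coe_addLeft, e0, e3, e4] at h
      linarith
    have f0 : s - 0 = s := sub_zero s
    have f3 : s - 3 = s + 2 := by linear_combination (-1 : Fin 5) * five_eq_zero_fin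
    have f4 : s - 4 = s + 1 := by linear_combination (-1 : Fin 5) * five_eq_zero_fin
    rw [Fin.sum_univ_five, f0, f3, f4, h3, h4, h0]
    linear_combination (α i 1 + α i 2) * hm
  -- the constant is `0`
  have hC : C = 0 := by
    have hsum : ∑ t : Fin 5, ∑ i, ∑ a, c i (t - a) * α i a = 0 := by
      rw [Finset.sum_comm]
      refine Finset.sum_eq_zero fun i _ => ?_
      rw [Finset.sum_comm]
      refine Finset.sum_eq_zero fun a _ => ?_
      rw [← Finset.sum_mul, Fintype.sum_equiv (Equiv.subRight a) (fun t => c i (t - a)) (c i) (fun _ => rfl), hc0 i, zero_mul]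
    have h5 : ∑ t : Fin 5, ∑ i, ∑ a, c i (t - a) * α i a = 5 * C := by
      rw [Finset.sum_congr rfl fun t _ => hP t, Finset.sum_const, Finset.card_univ, Fintype.card_fin, nsmul_eq_mul]
      norm_num
    linarith
  have hxy := hF (fun i => -5 * (α i 1 + α i 2)) (fun i => α i 1 - α i 2) (fun s => by
    have h2 : ∑ i, 2 * ∑ a, c i (s - a) * α i a = 0 := by rw [← Finset.mul_sum, hP s, hC, mul_zero]
    rw [← h2]
    exact Finset.sum_congr rfl fun i _ => (hexp i s).symm)
  intro i
  have h1 : α i 1 = 0 := by have := hxy i; linarith [this.1, this.2]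
  have h2 : α i 2 = 0 := by have := hxy i; linarith [this.1, this.2]
  have h0' : α i 0 = 0 := by rw [h0, h1, h2]; ring
  intro a
  fin_cases a
  · exact h0'
  · exact h1
  · exact h2
  · exact (h3 i).trans h2
  · exact (h4 i).trans h1

end Identities

/-! ## §2 Separation over the dihedral pentagon -/

section Dihedral

variable {H : Finset (Equiv.Perm (Fin 5))}

/-- **SEPARATION OVER THE DIHEDRAL PENTAGON.**  `H ⊆ Sym(ℤ/5)` containing every rotation `x ↦ x + t` and every reflection `x ↦ t − x`; position sets `Q_i`, defects
`u_i` (`i ∈ ι`); if the total signed sum `Σ_i Σ_a ±_{σ a ∈ Q_i} u_i(a)` is the same for every `σ ∈ H`, and the centred indicators `c_i = 5·𝟙_{Q_i} − |Q_i|` admit no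
relation `Σ_i (x_i c_i + y_i A c_i) = 0` over `ℚ` other than the trivial one (`A c(s) = c(s+1) + c(s−1) − c(s+2) − c(s−2)`; independence over `ℚ[A] ≅ ℚ(√5)`), then
every `u_i` is constant.  See the module docstring for the proof. [cite: Serre1977, §2.3 Ex. 2.6; §5.3] [cite: Washington1997, Lemma 2.4] [cite: Lang2002, XIII §4] -/
theorem const_of_signed_dihedral_five {ι : Type} [Fintype ι] (hrot : ∀ t : Fin 5, Equiv.addRight t ∈ H) (hrefl : ∀ t : Fin 5, Equiv.subLeft t ∈ H)
    (Q : ι → Finset (Fin 5)) (u : ι → Fin 5 → ℤ) {w : ℤ}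
    (h : ∀ σ ∈ H, (∑ i, ∑ a : Fin 5, (if σ a ∈ Q i then u i a else -u i a)) = w)
    (c : ι → Fin 5 → ℚ) (hc : ∀ i s, c i s = 5 * (if s ∈ Q i then 1 else 0) - (Q i).card)
    (hF : ∀ x y : ι → ℚ, (∀ s : Fin 5, ∑ i, (x i * c i s + y i * (c i (s + 1) + c i (s - 1) - c i (s + 2) - c i (s - 2))) = 0) →
      ∀ i, x i = 0 ∧ y i = 0)
    (i : ι) (a b : Fin 5) : u i a = u i b := by
  -- centred defects, in `ℚ`
  set S : ι → ℚ := fun i => ∑ a, (u i a : ℚ) with hS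
  set ub : ι → Fin 5 → ℚ := fun i a => 5 * (u i a : ℚ) - S i with hub
  have hc0 : ∀ i, ∑ s, c i s = 0 := fun i => by
    simp only [hc, Finset.sum_sub_distrib, ← Finset.mul_sum, Finset.sum_boole, Finset.sum_const, Finset.card_univ, Fintype.card_fin,
      nsmul_eq_mul]
    simp
  have hubsum : ∀ i, ∑ a, ub i a = 0 := fun i => by
    simp only [hub, Finset.sum_sub_distrib, ← Finset.mul_sum, Finset.sum_const, Finset.card_univ, Fintype.card_fin, nsmul_eq_mul]
    ring
  -- the pairing `G(σ) = Σ_i Σ_a c_i(σ a) ū_i(a)` is the same for every `σ ∈ H`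
  set K : ℚ := (25 * (w : ℚ) + ∑ i, (25 - 10 * ((Q i).card : ℚ)) * S i) / 2 with hK
  have hG : ∀ σ ∈ H, ∑ i, ∑ a, c i (σ a) * ub i a = K := by
    intro σ hσ
    have hw : (∑ i, ∑ a : Fin 5, (if σ a ∈ Q i then (u i a : ℚ) else -(u i a : ℚ))) = w := by
      have := congrArg (Int.cast : ℤ → ℚ) (h σ hσ)
      push_cast at this
      exact this
    have hsum : 2 * ∑ i, ∑ a, c i (σ a) * ub i a = 25 * (w : ℚ) + ∑ i, (25 - 10 * ((Q i).card : ℚ)) * S i := by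
      rw [← hw, Finset.mul_sum, Finset.mul_sum, ← Finset.sum_add_distrib]
      refine Finset.sum_congr rfl fun i _ => ?_
      have h2 := two_mul_sum_centred_mul_centred σ (Q i) (fun a => (u i a : ℚ))
      simp only [Nat.cast_ofNat] at h2
      have hl : ∑ a, c i (σ a) * ub i a = ∑ a, ((5 : ℚ) * (if σ a ∈ Q i then 1 else 0) - (Q i).card) * ((5 : ℚ) * (u i a : ℚ) - ∑ b, (u i b : ℚ)) :=
        Finset.sum_congr rfl fun a _ => by rw [hc, hub]
      rw [hl, h2]
      simp only [hS]
      ring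
    rw [hK, ← hsum]
    ring
  have hX : ∀ t : Fin 5, ∑ i, ∑ a, c i (a + t) * ub i a = K := fun t => hG _ (hrot t)
  have hY : ∀ t : Fin 5, ∑ i, ∑ a, c i (t - a) * ub i a = K := fun t => hG _ (hrefl t)
  -- symmetric and antisymmetric parts
  set α : ι → Fin 5 → ℚ := fun i a => ub i a + ub i (-a) with hα
  set β : ι → Fin 5 → ℚ := fun i a => ub i a - ub i (-a) with hβ
  have hX' : ∀ t : Fin 5, ∑ i, ∑ a, c i (t - a) * ub i (-a) = K := fun t => by
    rw [← hX t]
    refine Finset.sum_congr rfl fun i _ => ?_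
    rw [← Equiv.sum_comp (Equiv.neg (Fin 5)) (fun a => c i (t - a) * ub i (-a))]
    refine Finset.sum_congr rfl fun a _ => ?_
    simp only [Equiv.neg_apply, neg_neg, sub_neg_eq_add, add_comm]
  have hPα : ∀ t : Fin 5, ∑ i, ∑ a, c i (t - a) * α i a = 2 * K := fun t => by
    have e : ∑ i, ∑ a, c i (t - a) * α i a = ∑ i, ∑ a, c i (t - a) * ub i a + ∑ i, ∑ a, c i (t - a) * ub i (-a) := by
      rw [← Finset.sum_add_distrib]
      refine Finset.sum_congr rfl fun i _ => ?_
      rw [← Finset.sum_add_distrib]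
      exact Finset.sum_congr rfl fun a _ => by rw [hα]; ring
    rw [e, hY t, hX' t]; ring
  have hMβ : ∀ t : Fin 5, ∑ i, ∑ a, c i (t - a) * β i a = 0 := fun t => by
    have e : ∑ i, ∑ a, c i (t - a) * β i a = ∑ i, ∑ a, c i (t - a) * ub i a - ∑ i, ∑ a, c i (t - a) * ub i (-a) := by
      rw [← Finset.sum_sub_distrib]
      refine Finset.sum_congr rfl fun i _ => ?_
      rw [← Finset.sum_sub_distrib]
      exact Finset.sum_congr rfl fun a _ => by rw [hβ]; ring
    rw [e, hY t, hX' t]; ring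
  have hαsym : ∀ i a, α i (-a) = α i a := fun i a => by simp only [hα, neg_neg]; ring
  have hβanti : ∀ i a, β i (-a) = -β i a := fun i a => by simp only [hβ, neg_neg]; ring
  have hneg : ∀ i, ∑ a, ub i (-a) = 0 := fun i =>
    (Fintype.sum_equiv (Equiv.neg (Fin 5)) (fun a => ub i (-a)) (ub i) fun _ => rfl).trans (hubsum i)
  have hαmass : ∀ i, ∑ a, α i a = 0 := fun i => by
    simp only [hα, Finset.sum_add_distrib]; rw [hubsum i, hneg i, add_zero]
  have hα0 := symm_eq_zero_of_fIndependent c hc0 hF α hαsym hαmass hPα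
  -- the antisymmetric parts through `γ_i(a) = β_i(a − 1) − β_i(a + 1)`
  set γ : ι → Fin 5 → ℚ := fun i a => β i (a - 1) - β i (a + 1) with hγ
  have hγsym : ∀ i a, γ i (-a) = γ i a := fun i a => by
    simp only [hγ]
    have e1 : -a - 1 = -(a + 1) := by ring
    have e2 : -a + 1 = -(a - 1) := by ring
    rw [e1, e2, hβanti, hβanti]; ring
  have hγmass : ∀ i, ∑ a, γ i a = 0 := fun i => by
    simp only [hγ, Finset.sum_sub_distrib]
    rw [Fintype.sum_equiv (Equiv.subRight (1 : Fin 5)) (fun a => β i (a - 1)) (β i) fun _ => rfl,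
      Fintype.sum_equiv (Equiv.addRight (1 : Fin 5)) (fun a => β i (a + 1)) (β i) fun _ => rfl, sub_self]
  have hPγ : ∀ t : Fin 5, ∑ i, ∑ a, c i (t - a) * γ i a = 0 := fun t => by
    have e1 : ∑ i, ∑ a, c i (t - a) * β i (a - 1) = ∑ i, ∑ a, c i ((t - 1) - a) * β i a := by
      refine Finset.sum_congr rfl fun i _ => ?_
      rw [← Equiv.sum_comp (Equiv.addRight (1 : Fin 5)) (fun a => c i (t - a) * β i (a - 1))]
      refine Finset.sum_congr rfl fun a _ => ?_
      simp only [Equiv.coe_addRight, add_sub_cancel_right]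
      congr 2; ring
    have e2 : ∑ i, ∑ a, c i (t - a) * β i (a + 1) = ∑ i, ∑ a, c i ((t + 1) - a) * β i a := by
      refine Finset.sum_congr rfl fun i _ => ?_
      rw [← Equiv.sum_comp (Equiv.subRight (1 : Fin 5)) (fun a => c i (t - a) * β i (a + 1))]
      refine Finset.sum_congr rfl fun a _ => ?_
      simp only [Equiv.subRight_apply, sub_add_cancel]
      congr 2; ring
    have e : ∑ i, ∑ a, c i (t - a) * γ i a = ∑ i, ∑ a, c i (t - a) * β i (a - 1) - ∑ i, ∑ a, c i (t - a) * β i (a + 1) := by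
      rw [← Finset.sum_sub_distrib]
      refine Finset.sum_congr rfl fun i _ => ?_
      rw [← Finset.sum_sub_distrib]
      exact Finset.sum_congr rfl fun a _ => by rw [hγ]; ring
    rw [e, e1, e2, hMβ, hMβ, sub_self]
  have hγ0 := symm_eq_zero_of_fIndependent c hc0 hF γ hγsym hγmass (C := 0) hPγ
  have hβ0 : ∀ i a, β i a = 0 := by
    intro i
    have b0 : β i 0 = 0 := by simp only [hβ, neg_zero, sub_self]
    have b3 : β i 3 = -β i 2 := by
      have e : (-2 : Fin 5) = 3 := by decide
      have := hβanti i 2; rwa [e] at this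
    have b4 : β i 4 = -β i 1 := by
      have e : (-1 : Fin 5) = 4 := by decide
      have := hβanti i 1; rwa [e] at this
    have g1 : β i 0 - β i 2 = 0 := by
      have := hγ0 i 1
      simp only [hγ] at this
      have e1 : (1 : Fin 5) - 1 = 0 := by decide
      have e2 : (1 : Fin 5) + 1 = 2 := by decide
      rwa [e1, e2] at this
    have g2 : β i 1 - β i 3 = 0 := by
      have := hγ0 i 2
      simp only [hγ] at this
      have e1 : (2 : Fin 5) - 1 = 1 := by decide
      have e2 : (2 : Fin 5) + 1 = 3 := by decide
      rwa [e1, e2] at this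
    have b2 : β i 2 = 0 := by linarith
    have b1 : β i 1 = 0 := by linarith
    intro a
    fin_cases a
    · exact b0
    · exact b1
    · exact b2
    · show β i 3 = 0
      rw [b3, b2, neg_zero]
    · show β i 4 = 0
      rw [b4, b1, neg_zero]
  have hub0 : ∀ i a, ub i a = 0 := fun i a => by
    have h1 := hα0 i a
    have h2 := hβ0 i a
    simp only [hα, hβ] at h1 h2
    linarith
  have ha := hub0 i a
  have hb := hub0 i b
  simp only [hub] at ha hb
  have hq : (u i a : ℚ) = u i b := by linarith
  exact_mod_cast hq

end Dihedral

end Summit.HodgeConjecture.CorCM.MultiFieldWeil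

end
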